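import Summits.Ventures.DiscreteObjects.Hadamard.AutStructureSummary668
import Summits.Ventures.DiscreteObjects.Hadamard.Order225Excluded668
import Summits.Ventures.DiscreteObjects.Hadamard.CompositeOrderCRT668B
import Summits.Ventures.DiscreteObjects.Hadamard.PrimeCubeOrder5

/-!
# Hadamard 668 census, family F12 — the gen-18 additions to the odd part of Aut± H(668) in ONE statement
# (kernel summary B: the prime 5, orders 123 / 69 / 55)

Framing: lottery ticket; floor = certified bounds/negative ranges.

Cell pub-namedobj (venture DiscreteObjects), target (H), hadamard gen 18.  `AutStructureSummary668` (p319073) packaged the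
census as of the start of gen 18 (prime spectrum, `p² ∤ orderOf` for `p ≥ 7`, no `C_p × C_p` for `p ≥ 7`, structure at
`5` and `3`, the composite table).  This file adds, for a Hadamard matrix `H` of order `668` and its signed
automorphisms `(π, κ, d, e)`, the gen-18 results as one conjunction **`hadamard668_aut_structure_summary_B`**:
1. `5³ ∤ orderOf (π, κ)` (`PrimeCubeOrder5`);
2. `25·q ∤ orderOf (π, κ)` for `q ∈ {7, 11, 13, 23, 37, 41, 83, 167}` (`Order25TimesPrime668`) and `225 ∤ orderOf (π, κ)`
   (`Order225Excluded668`) — so the odd part of an order divisible by `25` is `25` or `75`;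
3. pair-order `25` ⇒ exactly `8` fixed rows and `8` fixed columns, fifth power exactly `68 + 68`
   (`Order25FixedEight668`);
4. pair-order `123` ⇒ the `3`-parts fix exactly `164` rows / columns and no row / column is fixed by the element
   (`CompositeOrderCRT668`);
(orders `69` and `55`: the four / seven admissible fixed-point triples are `hadamard668_order69_structure'` and
`hadamard668_order55_structure'` in `CompositeOrderCRT668B`, not restated here).
PAPER STEP (group theory, not kernel): with 1.–2., `49 ∤` and the prime spectrum, the order of every element of odd
order of Aut± H(668) divides `3^a · 5^b · 7 · 11 · 13 · 23 · 37 · 41 · 83 · 167` with `b ≤ 2`, and `b = 2` forces the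
odd part to be `25` or `75`.  NOTHING here excludes H(668) or asserts that any automorphism exists; HITS 0/4.
Ours; no `sorry`, no definitions.
-/

namespace Summit.Ventures.DiscreteObjects.Hadamard

open Finset BigOperators Matrix

open Literature.Combinatorics.Designs.GoethalsSeidel (IsHadamardMatrix)

variable {ι : Type*} [Fintype ι] [DecidableEq ι]

/-- **Gen-18 additions to the odd part of Aut± H(668), kernel summary** (see the module docstring). -/
theorem hadamard668_aut_structure_summary_B {H : Matrix ι ι ℤ} (hH : IsHadamardMatrix H)
    (hι : Fintype.card ι = 668) :
    -- 1. no element of order 125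
    (∀ (π κ : Equiv.Perm ι) (d e : ι → ℤ), IsSignedAut H π κ d e →
      ¬ 5 ^ 3 ∣ orderOf ((π, κ) : Equiv.Perm ι × Equiv.Perm ι)) ∧
    -- 2. no element of order 25·q (q ≥ 7 prime of the spectrum) nor of order 225
    (∀ (π κ : Equiv.Perm ι) (d e : ι → ℤ), IsSignedAut H π κ d e → ∀ q : ℕ,
      (q = 7 ∨ q = 11 ∨ q = 13 ∨ q = 23 ∨ q = 37 ∨ q = 41 ∨ q = 83 ∨ q = 167) →
      ¬ 25 * q ∣ orderOf ((π, κ) : Equiv.Perm ι × Equiv.Perm ι)) ∧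
    (∀ (π κ : Equiv.Perm ι) (d e : ι → ℤ), IsSignedAut H π κ d e →
      ¬ 225 ∣ orderOf ((π, κ) : Equiv.Perm ι × Equiv.Perm ι)) ∧
    -- 3. order 25: exactly 8 + 8 fixed, fifth power 68 + 68
    (∀ (π κ : Equiv.Perm ι) (d e : ι → ℤ), IsSignedAut H π κ d e → π ^ 25 = 1 → κ ^ 25 = 1 →
      (π ^ 5 ≠ 1 ∨ κ ^ 5 ≠ 1) →
      (univ.filter fun i => π i = i).card = 8 ∧ (univ.filter fun j => κ j = j).card = 8 ∧
      (univ.filter fun i => (π ^ 5) i = i).card = 68 ∧ (univ.filter fun j => (κ ^ 5) j = j).card = 68) ∧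
    -- 4. order 123: fixed-point-free, 3-parts fix exactly 164
    (∀ (π κ : Equiv.Perm ι) (d e : ι → ℤ), IsSignedAut H π κ d e → π ^ (3 * 41) = 1 → κ ^ (3 * 41) = 1 →
      (π ^ 41 ≠ 1 ∨ κ ^ 41 ≠ 1) → (π ^ 3 ≠ 1 ∨ κ ^ 3 ≠ 1) →
      (univ.filter fun j => (κ ^ 41) j = j).card = 164 ∧
      (univ.filter fun j => (κ ^ 41) j = j ∧ (κ ^ 3) j = j).card = 0 ∧
      (univ.filter fun i => (π ^ 41) i = i).card = 164 ∧
      (univ.filter fun i => (π ^ 41) i = i ∧ (π ^ 3) i = i).card = 0) := by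
  refine ⟨?_, ?_, ?_, ?_, ?_⟩
  · intro π κ d e haut hdvd
    exact hadamard668_signedAut_not_dvd_orderOf_125 hH hι π κ d e haut hdvd
  · intro π κ d e haut q hq hdvd
    exact hadamard668_signedAut_not_dvd_orderOf_25q hH hι π κ d e haut hq hdvd
  · intro π κ d e haut hdvd
    exact hadamard668_signedAut_not_dvd_orderOf_225 hH hι π κ d e haut hdvd
  · intro π κ d e haut hπ hκ hne
    exact hadamard668_order25_fixed_eight hH hι π κ d e haut hπ hκ hne
  · intro π κ d e haut hπ hκ h41 h3
    exact hadamard668_order123_fpf hH hι π κ d e haut hπ hκ h41 h3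

end Summit.Ventures.DiscreteObjects.Hadamard
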